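import Literature.Topology.FourManifolds.MMSWRasmussenFacts
import Summits.SmoothPoincare4.SmoothPoincare4.Theorems.DottedCircleRasmussenDcrGapHelperFriendsCarrierExterior
import Summits.SmoothPoincare4.SmoothPoincare4.Theorems.DottedCircleRasmussenDcrGapStubFriendsH2Aux
import Summits.SmoothPoincare4.SmoothPoincare4.Theorems.DottedCircleRasmussenDcrGapStubFriendsH2Aux2
import Summits.SmoothPoincare4.SmoothPoincare4.Theorems.DottedCircleRasmussenDcrGapStubFriendsH2Aux3

/-!
# Aux file 4 of stub `stub_friendsH2` (line `mk_friends`, crux `DcrGap`): the model disc exterior in `S⁴`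
(item stmt-SmoothPoincare4-16128, route route-SmoothPoincare4-DottedCircleRasmussen)

The comparison space of the `H₂`-leaf of the friends lemma.  For a model knot `K₁ ⊂ ∂D_k` with a
model slice disc `Δ₁ = f₁(𝔻²)` (`MMSW.IsModelSliceDisc k K₁ f₁`), the model disc exterior
`E = ℝ⁴ ∖ (D_k ∪ Δ₁)` is, through the stereographic embedding `σ : ℝ⁴ ≅ S⁴ ∖ {N}`, the complement in
`S⁴` of the closed set `C' = σD_k ∪ (σΔ₁ ∪ {N})`.  Since `H_q(S⁴; ℚ) = 0` (`q = 1, 2, 3`), the long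
exact sequence of the pair gives `H₂(E; ℚ) ≅ H₃(S⁴ | C')`, `H₁(E; ℚ) ≅ H₂(S⁴ | C')`, and the
relative Mayer–Vietoris count of Aux file 1 along `C' = σD_k ∪ (σΔ₁ ∪ {N})` — the two pieces meet in
the circle `σK₁`, and `H₄(S⁴ | σD_k) → H₄(S⁴ | σK₁)` is onto because `H₄(S⁴) ≅ H₄(S⁴ | σK₁)` — yields

* `FriendsH2.sphereCount` — **`H₂(E; ℚ)`, `H₁(E; ℚ)` are finite-dimensional and
  `dim H₂(E; ℚ) - dim H₁(E; ℚ) = p₃ - 1 - p₂`**, where `p_q = dim_ℚ H_q(ℝ⁴ | D_k; ℚ)`, GIVEN that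
  these two local homology groups of `ℝ⁴` along the model handlebody are finite-dimensional.

This is the `k ≥ 1` counterpart of the tree's `SliceDiscExteriorHomology.lean` (`k = 0`:
`H₁(B̊⁴ ∖ Δ) ≅ M`, `H₂ = 0`), in the weak, rank-only form that the Euler-characteristic argument of
the main file consumes (Manolescu–Piccirillo 2023, §3.2, proof of Lemma 3.3).  Everything is proved;
no definitions, no named facts, no `sorry`.

## References

* A. Hatcher, *Algebraic Topology*, CUP 2002, Thm. 2.16, §2.2 p. 152, Prop. 2B.1. [HatcherAT2002]
* C. Manolescu, L. Piccirillo, J. Lond. Math. Soc. 108 (2023), §3.2. [ManolescuPiccirillo2023]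
-/

-- the prescribed namespace `Summit.<P>.<Sub>.…` duplicates `SmoothPoincare4` (P = Sub)
set_option linter.dupNamespace false
set_option linter.style.longLine false

noncomputable section

open scoped Manifold ContDiff
open CategoryTheory Limits Set Function Metric Topology
open Literature.AlgebraicTopology.SingularHomology Literature.Topology.FourManifolds
open Literature.Topology.FourManifolds.MMSW

namespace Summit.SmoothPoincare4.SmoothPoincare4.Theorems.DcrGap.MkFriends

namespace FriendsH2

/-- Local notation: the `4`-sphere `S⁴ ⊂ ℝ⁵`. -/
local notation "𝕊⁴" => (Metric.sphere (0 : EuclideanSpace ℝ (Fin 5)) 1)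

/-- **`D_k ∩ Δ₁ = K₁`**: the model handlebody and a model slice disc meet exactly along the knot
(the open disc misses `D_k`, the boundary circle is `K₁ ⊂ ∂D_k`).
[cite: ManolescuMarengonSarkarWillis2023, Def. 8.14] -/
theorem modelHandlebody_inter_image_disc_eq {k : ℕ}
    {K₁ : (Metric.sphere (0 : EuclideanSpace ℝ (Fin 2)) 1) → EuclideanSpace ℝ (Fin 4)}
    {f₁ : EuclideanSpace ℝ (Fin 2) → EuclideanSpace ℝ (Fin 4)}
    (hK₁ : IsModelKnot k K₁) (hf₁ : IsModelSliceDisc k K₁ f₁) :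
    modelHandlebody k ∩ f₁ '' Metric.closedBall (0 : EuclideanSpace ℝ (Fin 2)) 1 = range K₁ := by
  ext y
  constructor
  · rintro ⟨hyD, x, hx, rfl⟩
    have hx1 : ‖x‖ = 1 := by
      rcases (mem_closedBall_zero_iff.1 hx).lt_or_eq with h1 | h1
      · exact absurd hyD (hf₁.apply_notMem h1)
      · exact h1
    exact ⟨⟨x, mem_sphere_zero_iff_norm.2 hx1⟩, (hf₁.apply_sphere ⟨x, mem_sphere_zero_iff_norm.2 hx1⟩).symm⟩
  · rintro ⟨t, rfl⟩
    exact ⟨modelBoundary_subset_modelHandlebody (hK₁.mem t),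
      ⟨(t : EuclideanSpace ℝ (Fin 2)), Metric.sphere_subset_closedBall t.2, hf₁.apply_sphere t⟩⟩

/-- **The model disc exterior counted in `S⁴`.**  For a model knot `K₁ ⊂ ∂D_k` with model slice
disc `Δ₁ = f₁(𝔻²)` and `E = ℝ⁴ ∖ (D_k ∪ Δ₁)`: if `H₂(ℝ⁴ | D_k; ℚ)`, `H₃(ℝ⁴ | D_k; ℚ)` are
finite-dimensional then so are `H₂(E; ℚ)`, `H₁(E; ℚ)`, and
`dim H₂(E; ℚ) - dim H₁(E; ℚ) = dim H₃(ℝ⁴ | D_k; ℚ) - 1 - dim H₂(ℝ⁴ | D_k; ℚ)`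
(long exact sequence of `(S⁴, σE)` and relative Mayer–Vietoris along `σD_k ∪ (σΔ₁ ∪ {N})`; the
`k ≥ 1` counterpart of the tree's `SliceDiscExteriorHomology.lean`, Manolescu–Piccirillo 2023, §3.2).
[cite: ManolescuPiccirillo2023, §3.2, proof of Lemma 3.3] [cite: HatcherAT2002, Thm. 2.16 and §2.2 p. 152] -/
theorem sphereCount {k : ℕ}
    {K₁ : (Metric.sphere (0 : EuclideanSpace ℝ (Fin 2)) 1) → EuclideanSpace ℝ (Fin 4)}
    {f₁ : EuclideanSpace ℝ (Fin 2) → EuclideanSpace ℝ (Fin 4)}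
    (hK₁ : IsModelKnot k K₁) (hf₁ : IsModelSliceDisc k K₁ f₁)
    {E : Set (EuclideanSpace ℝ (Fin 4))}
    (hE : E = {x | x ∉ modelHandlebody k ∧ x ∉ f₁ '' Metric.closedBall (0 : EuclideanSpace ℝ (Fin 2)) 1})
    [Module.Finite ℚ (localHomologyOfSet ℚ ℚ (EuclideanSpace ℝ (Fin 4)) (modelHandlebody k) 2)]
    [Module.Finite ℚ (localHomologyOfSet ℚ ℚ (EuclideanSpace ℝ (Fin 4)) (modelHandlebody k) 3)] :
    Module.Finite ℚ (singularHomology ℚ ℚ E 2) ∧ Module.Finite ℚ (singularHomology ℚ ℚ E 1) ∧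
      (Module.finrank ℚ (singularHomology ℚ ℚ E 2) : ℤ) - Module.finrank ℚ (singularHomology ℚ ℚ E 1) =
        Module.finrank ℚ (localHomologyOfSet ℚ ℚ (EuclideanSpace ℝ (Fin 4)) (modelHandlebody k) 3) - 1 -
          Module.finrank ℚ (localHomologyOfSet ℚ ℚ (EuclideanSpace ℝ (Fin 4)) (modelHandlebody k) 2) := by
  obtain ⟨N, σ, hσ, hσN⟩ := exists_isOpenEmbedding_range_eq_compl_singleton
  -- notation
  set Dk : Set (EuclideanSpace ℝ (Fin 4)) := modelHandlebody k with hDk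
  set Δ₁ : Set (EuclideanSpace ℝ (Fin 4)) := f₁ '' Metric.closedBall (0 : EuclideanSpace ℝ (Fin 2)) 1
    with hΔ₁
  set A' : Set 𝕊⁴ := σ '' Dk with hA'
  set B' : Set 𝕊⁴ := σ '' Δ₁ ∪ {N} with hB'
  have hNσ : ∀ x, σ x ≠ N := fun x hx => by
    have : σ x ∈ range σ := mem_range_self x
    rw [hσN] at this
    exact this hx
  -- compactness / closedness
  have hDkc : IsCompact Dk := isCompact_modelHandlebody k
  have hf₁c : Continuous f₁ := hf₁.1.continuous
  have hΔ₁c : IsCompact Δ₁ := (isCompact_closedBall _ _).image hf₁c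
  have hA'c : IsClosed A' := (hDkc.image hσ.continuous).isClosed
  have hσΔc : IsClosed (σ '' Δ₁) := (hΔ₁c.image hσ.continuous).isClosed
  have hB'c : IsClosed B' := hσΔc.union isClosed_singleton
  -- the circle `σ ∘ K₁`
  have hγc : Continuous (σ ∘ K₁) := hσ.continuous.comp hK₁.continuous
  have hγi : Injective (σ ∘ K₁) := hσ.injective.comp hK₁.2.1
  have hγ : IsEmbedding (σ ∘ K₁) := (hγc.isClosedEmbedding hγi).isEmbedding
  have hΓA : range (σ ∘ K₁) ⊆ A' := by
    rintro _ ⟨t, rfl⟩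
    exact ⟨K₁ t, modelBoundary_subset_modelHandlebody (hK₁.mem t), rfl⟩
  have hAB : A' ∩ B' = range (σ ∘ K₁) := by
    rw [hB', inter_union_distrib_left, hA', ← image_inter hσ.injective,
      modelHandlebody_inter_image_disc_eq hK₁ hf₁, ← range_comp]
    have h0 : σ '' Dk ∩ {N} = ∅ := by
      rw [Set.inter_singleton_eq_empty]
      rintro ⟨x, -, hx⟩
      exact hNσ x hx
    rw [h0, union_empty]
  -- local homology along `B'`, `Γ'`, `A'`
  have hNΔ : N ∉ σ '' Δ₁ := by
    rintro ⟨x, -, hx⟩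
    exact hNσ x hx
  have hB'0 : ∀ q : ℕ, 2 ≤ q → q ≤ 3 → IsZero (localHomologyOfSet ℚ ℚ 𝕊⁴ B' q) := fun q hq2 hq3 =>
    isZero_localHomologyOfSet_union_singleton ℚ ℚ hσΔc hNΔ (by omega)
      (isZero_localHomologyOfSet_sphere_image_disc hσ.continuous hσ.injective hf₁c hf₁.2.1 ℚ ℚ hq2 hq3)
  obtain ⟨hΓfin, hΓ3⟩ := finite_and_finrank_localHomologyOfSet_circle_three (σ ∘ K₁) hγ
  haveI := hΓfin
  obtain ⟨TA2, -, -⟩ := localHomologyOfSet.exists_linearEquiv_pair_of_isOpenEmbedding ℚ ℚ hσ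
    (subset_refl Dk) hA'c hA'c 2
  obtain ⟨TA3, -, -⟩ := localHomologyOfSet.exists_linearEquiv_pair_of_isOpenEmbedding ℚ ℚ hσ
    (subset_refl Dk) hA'c hA'c 3
  haveI : Module.Finite ℚ (localHomologyOfSet ℚ ℚ 𝕊⁴ A' 2) := Module.Finite.equiv TA2
  haveI : Module.Finite ℚ (localHomologyOfSet ℚ ℚ 𝕊⁴ A' 3) := Module.Finite.equiv TA3
  -- the Mayer–Vietoris count
  obtain ⟨hfin3, hfin2, hcount⟩ := mvCount hA'c hB'c hAB hΓA (hB'0 2 le_rfl (by omega))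
    (hB'0 3 (by omega) le_rfl) (isZero_localHomologyOfSet_circle_two ℚ ℚ (σ ∘ K₁) hγ) hΓ3
    (surjective_restrictLocal_circle_four ℚ ℚ (σ ∘ K₁) hγ hΓA)
  rw [← TA2.finrank_eq, ← TA3.finrank_eq] at hcount
  haveI := hfin3
  haveI := hfin2
  -- the long exact sequence of `(S⁴, S⁴ ∖ C')`
  obtain ⟨⟨T3⟩, ⟨T2⟩⟩ := nonempty_linearEquiv_compl_sphere_four ℚ ℚ (A' ∪ B')
  -- `S⁴ ∖ C' = σE ≅ E`
  have hS : σ '' E = (A' ∪ B')ᶜ := by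
    ext y
    constructor
    · rintro ⟨x, hx, rfl⟩
      rw [hE] at hx
      rintro (⟨x', hx', hxx'⟩ | ⟨x', hx', hxx'⟩ | hy)
      · exact hx.1 (hσ.injective hxx' ▸ hx')
      · exact hx.2 (hσ.injective hxx' ▸ hx')
      · exact hNσ x hy
    · intro hy
      have hyN : y ∈ range σ := by
        rw [hσN]
        exact fun h => hy (Or.inr (Or.inr h))
      obtain ⟨x, rfl⟩ := hyN
      refine ⟨x, ?_, rfl⟩
      rw [hE]
      exact ⟨fun h => hy (Or.inl ⟨x, h, rfl⟩), fun h => hy (Or.inr (Or.inl ⟨x, h, rfl⟩))⟩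
  let Θ : E ≃ₜ ↥((A' ∪ B')ᶜ) := (hσ.isEmbedding.homeomorphImage E).trans (Homeomorph.setCongr hS)
  let X2 := (singularHomology.xEquiv ℚ ℚ Θ 2).trans T3.symm
  let X1 := (singularHomology.xEquiv ℚ ℚ Θ 1).trans T2.symm
  refine ⟨Module.Finite.equiv X2.symm, Module.Finite.equiv X1.symm, ?_⟩
  rw [X2.finrank_eq, X1.finrank_eq]
  exact hcount

end FriendsH2

/-- **Registered helper (aux 4 of `stub_friendsH2`)**: the model disc exterior `E = ℝ⁴ ∖ (D_k ∪ Δ₁)` counted in `S⁴` — `dim H₂(E; ℚ) - dim H₁(E; ℚ) = dim H₃(ℝ⁴ | D_k) - 1 - dim H₂(ℝ⁴ | D_k)` given finite-dimensionality of the latter (`FriendsH2.sphereCount`; Manolescu–Piccirillo 2023, §3.2). [cite: ManolescuPiccirillo2023, §3.2, proof of Lemma 3.3] -/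
theorem helper_friendsH2_sphereCount : ∀ (k : ℕ) (K₁ : (Metric.sphere (0 : EuclideanSpace ℝ (Fin 2)) 1) → EuclideanSpace ℝ (Fin 4)) (f₁ : EuclideanSpace ℝ (Fin 2) → EuclideanSpace ℝ (Fin 4)) (E : Set (EuclideanSpace ℝ (Fin 4))), Literature.Topology.FourManifolds.MMSW.IsModelKnot k K₁ → Literature.Topology.FourManifolds.MMSW.IsModelSliceDisc k K₁ f₁ → E = {x | x ∉ Literature.Topology.FourManifolds.MMSW.modelHandlebody k ∧ x ∉ f₁ '' Metric.closedBall (0 : EuclideanSpace ℝ (Fin 2)) 1} → Module.Finite ℚ (Literature.AlgebraicTopology.SingularHomology.localHomologyOfSet ℚ ℚ (EuclideanSpace ℝ (Fin 4)) (Literature.Topology.FourManifolds.MMSW.modelHandlebody k) 2) → Module.Finite ℚ (Literature.AlgebraicTopology.SingularHomology.localHomologyOfSet ℚ ℚ (EuclideanSpace ℝ (Fin 4)) (Literature.Topology.FourManifolds.MMSW.modelHandlebody k) 3) → Module.Finite ℚ (Literature.AlgebraicTopology.SingularHomology.singularHomology ℚ ℚ E 2) ∧ Module.Finite ℚ (Literature.AlgebraicTopology.SingularHomology.singularHomology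 ℚ ℚ E 1) ∧ (Module.finrank ℚ (Literature.AlgebraicTopology.SingularHomology.singularHomology ℚ ℚ E 2) : ℤ) - Module.finrank ℚ (Literature.AlgebraicTopology.SingularHomology.singularHomology ℚ ℚ E 1) = Module.finrank ℚ (Literature.AlgebraicTopology.SingularHomology.localHomologyOfSet ℚ ℚ (EuclideanSpace ℝ (Fin 4)) (Literature.Topology.FourManifolds.MMSW.modelHandlebody k) 3) - 1 - Module.finrank ℚ (Literature.AlgebraicTopology.SingularHomology.localHomologyOfSet ℚ ℚ (EuclideanSpace ℝ (Fin 4)) (Literature.Topology.FourManifolds.MMSW.modelHandlebody k) 2) := by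
  intro k K₁ f₁ E hK₁ hf₁ hE i₁ i₂
  haveI := i₁; haveI := i₂
  exact FriendsH2.sphereCount hK₁ hf₁ hE

end Summit.SmoothPoincare4.SmoothPoincare4.Theorems.DcrGap.MkFriends

end
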